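import Mathlib.Data.Finset.Sups
import Mathlib.Order.UpperLower.Basic
import Literature.Combinatorics.SetFamily.IdealComplementPairing

/-!
# `NoHeavyLowerTail` (crux stmt-CriticalPhenomena-4575), lane prim-ineq-gen-4 (gen 32): the anti-band inequality when one family has no small core member

Support file (`--supports stmt-CriticalPhenomena-4575`; memo `run/shared/lean/prim/prim-ineq-gen-4/FINDING-COVER-MATCHING-g32.md` §2).
Pure finite combinatorics, no definitions, no `sorry`, standard axioms.

CONTEXT.  The anti-band inequality (AB_l)(n) of the lane (memo FINDING-SHIFTING-AB-g20; bridge `AntiBandLevelHarrisBridge`): for up-sets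
`A, B` of `Finset (Fin n)`, `#{s ∈ A ∩ Bᶜˢ | #s < l ∨ #sᶜ < l} ≤ #{s ∈ A ∩ B | #s < l ∨ #sᶜ < l}` (conjectured for all `n ≥ 2l`; proved cell by
cell for `l ≤ 5` and for large `n`).  Gen 32 reformulated the conjecture as the existence of a fractional perfect matching of `B ∩ O`
(`O = {#s < l ∨ #sᶜ < l}`) by pairs `{v, y}` with `v ∪ y = univ`, whose Hall condition for families of small sets only / huge sets only is the
Marica–Schönheim inequality.  Via the Erdős–Herzog–Schönheim / Berge pairing of an ideal (`Literature.Combinatorics.SetFamily.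
exists_injOn_disjoint_of_isLowerSet`, itself Hall + Marica–Schönheim) this settles (AB_l)(n) — for EVERY `n` and `l` — for all pairs in which
the small members of `B` come with their complements:

**THEOREM (`antiBand_of_compl_mem_of_card_lt`).**  Let `A, B` be up-sets of `Finset (Fin n)` and suppose every `x ∈ B` with `#x < l` has `xᶜ ∈ B`
(equivalently: the intersecting core `B ∩ B*` of `B` has no member of size `< l`; e.g. `B ⊆ {s | l ≤ #s}`).  Then
`#{s ∈ A ∩ Bᶜˢ | #s < l ∨ #sᶜ < l} ≤ #{s ∈ A ∩ B | #s < l ∨ #sᶜ < l}`.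
By the symmetry of the two sides in `(A, B)` (`antiBand_symm`) the same holds with the hypothesis on `A` (`antiBand_of_compl_mem_of_card_lt'`).

PROOF.  The left side counts `x ∈ A ∩ O` with `xᶜ ∈ B`.  If `x ∈ B` map `x ↦ x`.  Otherwise `#x < l` (if `#xᶜ < l` then `xᶜ` is a small member of
`B`, so `x = xᶜᶜ ∈ B`), i.e. `x` lies in the ideal `I = {u | #u < l, uᶜ ∈ B, u ∉ B}`; the EHS pairing gives an injection `g : I → I` with
`u ∩ g u = ∅`, and `x ↦ (g x)ᶜ` lands in `A ∩ B ∩ O` (`(g x)ᶜ ⊇ x` is in the up-set `A`, `(g x)ᶜ ∈ B`, `#(g x)ᶜᶜ < l`).  The two branches have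
disjoint images (`(g x)ᶜ` has its complement `g x ∉ B`, while every image of the first branch has its complement in `B`).
-/

namespace Summit.CriticalPhenomena.PercolationContinuityZ3.Theorems.AntiBandNoSmallCore

open Finset
open scoped FinsetFamily

/-- **(AB_l)(n) when the small members of `B` come with their complements.**  For up-sets `A, B` of `Finset (Fin n)` such that every
`x ∈ B` with `#x < l` has `xᶜ ∈ B` (the intersecting core of `B` has no member of size `< l`):
`#{s ∈ A ∩ Bᶜˢ | #s < l ∨ #sᶜ < l} ≤ #{s ∈ A ∩ B | #s < l ∨ #sᶜ < l}` — for every `n` and `l`.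
[this work; memo FINDING-COVER-MATCHING-g32 §2; EHS pairing = Erdős–Herzog–Schönheim 1970 / Berge 1976] -/
theorem antiBand_of_compl_mem_of_card_lt {n : ℕ} (l : ℕ) (A B : Finset (Finset (Fin n)))
    (hA : IsUpperSet (A : Set (Finset (Fin n)))) (hB : IsUpperSet (B : Set (Finset (Fin n))))
    (hcore : ∀ x ∈ B, #x < l → xᶜ ∈ B) :
    #((A ∩ Bᶜˢ).filter fun s => #s < l ∨ #sᶜ < l) ≤ #((A ∩ B).filter fun s => #s < l ∨ #sᶜ < l) := by
  classical
  -- the ideal of small co-members of `B` that are not members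
  set I : Finset (Finset (Fin n)) := univ.filter fun u => #u < l ∧ uᶜ ∈ B ∧ u ∉ B with hIdef
  have hI : IsLowerSet (I : Set (Finset (Fin n))) := by
    intro u v hvu hu
    rw [mem_coe, hIdef, mem_filter] at hu ⊢
    obtain ⟨-, hul, huc, huB⟩ := hu
    refine ⟨mem_univ _, lt_of_le_of_lt (card_le_card hvu) hul, hB (compl_le_compl hvu) huc, fun hvB => huB (hB hvu hvB)⟩
  obtain ⟨g, hginj, hg⟩ := Literature.Combinatorics.SetFamily.exists_injOn_disjoint_of_isLowerSet I hI
  -- members of the left side outside `B` lie in `I`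
  have hmemI : ∀ x ∈ (A ∩ Bᶜˢ).filter (fun s => #s < l ∨ #sᶜ < l), x ∉ B → x ∈ I := by
    intro x hx hxB
    rw [mem_filter, mem_inter, mem_compls] at hx
    obtain ⟨⟨-, hxc⟩, hO⟩ := hx
    rw [hIdef, mem_filter]
    refine ⟨mem_univ _, ?_, hxc, hxB⟩
    rcases hO with h | h
    · exact h
    · exact absurd (by simpa using hcore xᶜ hxc h) hxB
  -- the injection
  let φ : Finset (Fin n) → Finset (Fin n) := fun x => if x ∈ B then x else (g x)ᶜ
  have hmaps : Set.MapsTo φ ((A ∩ Bᶜˢ).filter fun s => #s < l ∨ #sᶜ < l) ((A ∩ B).filter fun s => #s < l ∨ #sᶜ < l) := by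
    intro x hx
    have hx' := hx
    rw [mem_coe, mem_filter, mem_inter, mem_compls] at hx'
    obtain ⟨⟨hxA, hxc⟩, hO⟩ := hx'
    by_cases hxB : x ∈ B
    · simp only [φ, if_pos hxB]
      exact mem_coe.2 (mem_filter.2 ⟨mem_inter.2 ⟨hxA, hxB⟩, hO⟩)
    · simp only [φ, if_neg hxB]
      have hxI := hmemI x hx hxB
      obtain ⟨hgI, hdis⟩ := hg x hxI
      rw [hIdef, mem_filter] at hgI
      obtain ⟨-, hgl, hgc, -⟩ := hgI
      refine mem_coe.2 (mem_filter.2 ⟨mem_inter.2 ⟨?_, hgc⟩, Or.inr (by simpa using hgl)⟩)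
      exact hA (le_compl_iff_disjoint_right.2 hdis) hxA
  have hinj : Set.InjOn φ ((A ∩ Bᶜˢ).filter fun s => #s < l ∨ #sᶜ < l) := by
    intro x hx y hy hxy
    have hx' := hx
    have hy' := hy
    rw [mem_coe, mem_filter, mem_inter, mem_compls] at hx' hy'
    by_cases hxB : x ∈ B <;> by_cases hyB : y ∈ B
    · simpa only [φ, if_pos hxB, if_pos hyB] using hxy
    · simp only [φ, if_pos hxB, if_neg hyB] at hxy
      obtain ⟨hgI, -⟩ := hg y (hmemI y hy hyB)
      rw [hIdef, mem_filter] at hgI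
      exfalso
      have h := hx'.1.2
      rw [hxy, compl_compl] at h
      exact hgI.2.2.2 h
    · simp only [φ, if_neg hxB, if_pos hyB] at hxy
      obtain ⟨hgI, -⟩ := hg x (hmemI x hx hxB)
      rw [hIdef, mem_filter] at hgI
      exfalso
      have h := hy'.1.2
      rw [← hxy, compl_compl] at h
      exact hgI.2.2.2 h
    · simp only [φ, if_neg hxB, if_neg hyB] at hxy
      exact hginj (hmemI x hx hxB) (hmemI y hy hyB) (compl_injective hxy)
  exact card_le_card_of_injOn φ hmaps hinj

/-- **Symmetry of the anti-band functional.**  Both sides of (AB_l)(n) are symmetric in `(A, B)`: the right side trivially, the left side via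
`s ↦ sᶜ` (which preserves the outer region `{#s < l ∨ #sᶜ < l}` and maps `A ∩ Bᶜˢ` onto `B ∩ Aᶜˢ`). [folklore; this work] -/
theorem antiBand_symm {n : ℕ} (l : ℕ) (A B : Finset (Finset (Fin n))) :
    #((A ∩ Bᶜˢ).filter fun s => #s < l ∨ #sᶜ < l) = #((B ∩ Aᶜˢ).filter fun s => #s < l ∨ #sᶜ < l) := by
  classical
  refine card_bij (fun s _ => sᶜ) ?_ ?_ ?_
  · intro s hs
    rw [mem_filter, mem_inter, mem_compls] at hs ⊢
    rw [compl_compl]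
    exact ⟨⟨hs.1.2, hs.1.1⟩, hs.2.symm⟩
  · intro s _ t _ h
    exact compl_injective h
  · intro t ht
    refine ⟨tᶜ, ?_, compl_compl t⟩
    rw [mem_filter, mem_inter, mem_compls] at ht ⊢
    rw [compl_compl]
    exact ⟨⟨ht.1.2, ht.1.1⟩, ht.2.symm⟩

/-- **(AB_l)(n) when the small members of `A` come with their complements** (the symmetric form of
`antiBand_of_compl_mem_of_card_lt`). [this work] -/
theorem antiBand_of_compl_mem_of_card_lt' {n : ℕ} (l : ℕ) (A B : Finset (Finset (Fin n)))
    (hA : IsUpperSet (A : Set (Finset (Fin n)))) (hB : IsUpperSet (B : Set (Finset (Fin n))))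
    (hcore : ∀ x ∈ A, #x < l → xᶜ ∈ A) :
    #((A ∩ Bᶜˢ).filter fun s => #s < l ∨ #sᶜ < l) ≤ #((A ∩ B).filter fun s => #s < l ∨ #sᶜ < l) := by
  rw [antiBand_symm, inter_comm A B]
  exact antiBand_of_compl_mem_of_card_lt l B A hB hA hcore

/-- **Corollary: (AB_l)(n) when `B` has no member of size `< l`** (e.g. `B ⊆ {s | l ≤ #s}`, majority-type families). [this work] -/
theorem antiBand_of_le_card {n : ℕ} (l : ℕ) (A B : Finset (Finset (Fin n)))
    (hA : IsUpperSet (A : Set (Finset (Fin n)))) (hB : IsUpperSet (B : Set (Finset (Fin n))))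
    (hBl : ∀ x ∈ B, l ≤ #x) :
    #((A ∩ Bᶜˢ).filter fun s => #s < l ∨ #sᶜ < l) ≤ #((A ∩ B).filter fun s => #s < l ∨ #sᶜ < l) :=
  antiBand_of_compl_mem_of_card_lt l A B hA hB fun x hx hxl => absurd (hBl x hx) (not_le.2 hxl)

end Summit.CriticalPhenomena.PercolationContinuityZ3.Theorems.AntiBandNoSmallCore
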